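import Literature.MathematicalPhysics.QuantumFieldTheory.Balaban1983to89.B2Eq228Conditioning
import Literature.MathematicalPhysics.QuantumFieldTheory.Balaban1983to89.B13Term214

/-!
# `Balaban1983to89.B13Integral223` — T. Bałaban, *Renormalization group approach to lattice gauge field theories.
II. Cluster expansions*, Commun. Math. Phys. **116** (1988) 1–22 [Balaban1988RG2Cluster], p. 17: the Gaussian
integral (2.23), its `B`-integration (2.24), the `X`-integration (2.25), and the last factor `exp O(1)α₅|Z|` of
(2.26) — COMPUTED AND BOUNDED in the finite-dimensional Gaussian model of record (`B13GaugeDevices` §H)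

statement-level skeleton of published theorems with citation tags; proofs where landed; nothing here is a claim about
the Yang–Mills mass gap

PDF held: `paper:balaban1988-cmp116-rg-ii-cluster` (journal page = PDF page + 0); quotations read as images from
`run/shared/lean/pub/pub-balaban/b2b-balaban-ref1/pages/1988-cmp116-rg-II-cluster/1988-cmp116-rg-II-cluster-p015-x2.png`,
`…-p016-x2.png`, `…-p017-x2.png` (the publisher's text layer is garbled).

CITATION HEADER (verbatim).  P. 15 [PDF 15], after (2.14): *"For the pair (U, 0) the operators are symmetric, and the
measure is positive, and then the estimates are simpler. The general case is handled by a perturbative argument."*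
P. 16 [PDF 16], last line – p. 17 [PDF 17]: *"Applying the above estimates to the expressions under the integral in
(2.15), we obtain the following integral:
  `∫dμ₀(X)|_Z exp(−½⟨Γ_k(Z₀,0)X, C^{(k)}(Z₀,0)Γ_k(Z₀,0)X⟩ + ½α₅‖ZX‖²)
     · ∫dμ_{C^{(k)}(Z₀,0)}(B) exp(−⟨B, Γ_k(Z₀,0)X⟩ + ½α₅‖Z₀B‖²),`                                       (2.23)
where `α₅ = O(1)e^{−1/3δ₀M} + O(α₀ + α₁) + O(1)α₄ + γ₂`. It is a Gaussian integral, and can be easily calculated. At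
first we calculate the integral with respect to B, including the last two quadratic forms under the exponential into
the Gaussian measure. It is equal to
  `|det(C^{(k)}(Z₀,0)⁻¹) / det(C^{(k)}(Z₀,0)⁻¹ − α₅I)|^{1/2} · exp(½⟨Γ_k(Z₀,0)X, (C^{(k)}(Z₀,0)⁻¹ − α₅I)⁻¹Γ_k(Z₀,0)X⟩).` (2.24)
Of course we have assumed that α₅ is sufficiently small, e.g. `α₅‖C^{(k)}(Z₀,0)‖ < ½`. The factor with the
determinants can be estimated by `exp O(1)α₅|Z₀|`. The quadratic form under the exponential is expanded with respect
to α₅, and the zeroth order term cancels the first quadratic form under the first exponential in (2.23). The remainder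
can be estimated by `½O(α₅)‖ZX‖²`. In fact a better bound can be proved using localizations and the exponential decay
of operators in the above expressions, but we do not need such a bound. These calculations and estimates yield the
following integral
  `∫dμ₀(X)|_Z exp ½O(α₅)‖ZX‖² = Π_{b∈Z}(1 − O(α₅))^{1/2 d(𝔤)} ≦ exp(O(α₅)|Z|).`                        (2.25)
This ends the estimate of the expression (2.14). Gathering together all the bounds we get
  `|(2.14)| ≦ exp(−(κ₁ − 1)(LM)⁻⁴|Z∖Z′₀|)·[Π_{Y∈𝐃} 2E₀ε₁C₁α₄⁻¹M^q exp C₂κ₁ exp(−(1 − 3δ)κd_k(Y))]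
     · exp(−½γ₂(ε₁²/g_k²)|P|) · exp O(1)α₅|Z|.`                                                           (2.26)
As we have remarked already it is possible to get a better bound, e.g. with |Z₀| instead of |Z| in the last
exponential, by more careful estimates of the quadratic forms."*  [sic in (2.25): the exponent of `(1 − O(α₅))` is
`−½d(𝔤)`, cell DIVERGENCE D-b13.13, as already recorded in `B13PerturbativeStep`.]

WHAT IS REPRODUCED (unit `lit-balaban-r10` gen 8, B13 fold owner; SKELETON rows `B13.Def2.23` (the display (2.23) was
«absent (display, schematic)»), `B13.Eq2.24`, `B13.Eq2.25`, `B13.Eq2.26` (its last factor) and, for §7–§8, `B13.Eq2.15`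
/ `B13.Eq2.14` of `HOME/lit-balaban-r10/ROWS-B13.md`, HOME = `run/shared/lean/pub/lit-balaban/`).  THE MODEL is the
finite-dimensional Gaussian model of record of (2.5)–(2.6) and (2.14) (`B13GaugeDevices` §H, `B13Sect2Statements`
Part A, `B13Term214` Part B; DIVERGENCE D-b13.29): `Λ` = the real coordinates of the interior field `Z₀B` (bonds of
`Z₀` × colour components, so `Fintype.card Λ` reads `d(𝔤)·#bonds(Z₀) = O(1)|Z₀|`), `N` = the real coordinates of
`ZX` (`Fintype.card N = d(𝔤)·#bonds(Z) = O(1)|Z|`; *"∫dμ₀(X)|_Z"* — the restriction to `Z` is the choice of the index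
set), `C : Matrix Λ Λ ℝ` positive definite = the covariance `C^{(k)}(Z₀, 0)` (so `∫dμ_{C^{(k)}(Z₀,0)}(B)` =
`B13GaugeDevices.gaussMean C⁻¹`, precision `C⁻¹`), `Γ : Matrix Λ N ℝ` = `Γ_k(Z₀, 0)` acting on `X`, `dμ₀ =
gaussMean 1`, and `α = α₅`.  The two printed hypotheses enter as: `hc : λ_k(C) ≤ c` with `α·c ≤ ½` (*"α₅‖C^{(k)}(Z₀,0)‖
< ½"*, R14 of the cell census) and `hΓ : ⟨ΓX, CΓX⟩ ≤ g‖X‖²` (the operator norms `‖C^{(k)}(Z₀,0)‖, ‖Γ_k(Z₀,0)‖ = O(1)`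
of [13]/[15] — BY REFERENCE, cell locus L17a; here explicit constants `c, g ≥ 0`).
* §1 `innerB`, `integral223` — the `B`-integral and the whole display (2.23) as named objects (`def`s, the printed
  formulas verbatim in the model).
* §2 spectral plumbing for a positive definite `C` (`exists_spectral`: `C = U·diag(λ)·U*`, `C⁻¹ = U·diag(λ⁻¹)·U*`;
  `c⁻¹‖x‖² ≤ ⟨x, C⁻¹x⟩`, `⟨x, Cx⟩ ≤ c‖x‖²`) and **`posDef_inv_sub_smul`**: `αc < 1 ⇒ C⁻¹ − αI ≻ 0` — the content of
  *"Of course we have assumed that α₅ is sufficiently small, e.g. α₅‖C^{(k)}(Z₀,0)‖ < ½"* (it makes (2.24) a convergent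
  Gaussian integral).
* §3 **(2.24) PROVED EXACTLY**: `innerB_eq_224` — `∫dμ_C(B) e^{−⟨B,J⟩ + ½α‖B‖²} = √(det C⁻¹/det(C⁻¹ − αI)) ·
  exp(½⟨J, (C⁻¹ − αI)⁻¹J⟩)` for every source `J` (the linear shift `B13GaugeDevices.integral_linear_shift` at precision
  `C⁻¹ − αI` and the normalisations `B2Eq228Conditioning.gaussNorm_eq`); `innerB_eq_224_abs` is the display with the
  printed modulus signs.  Then *"The factor with the determinants can be estimated by exp O(1)α₅|Z₀|"*:
  `sqrt_det_ratio_le` (`≤ exp(αc·|Λ|)`, from `B13PerturbativeStep.det_ratio_le_exp_card`), the covariance expansion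
  `form_224_le` (`⟨J,(C⁻¹ − αI)⁻¹J⟩ ≤ (1 + 2αc)⟨J, CJ⟩`, from `B13PerturbativeStep.remainder_form_le`), and
  **`innerB_le`**: `(2.24) ≤ exp(αc|Λ|)·exp((½ + αc)⟨J, CJ⟩)`.
* §4 **(2.25) PROVED**: `outer_225_eq` — `∫dμ₀(X)|_Z exp ½a‖ZX‖² = ((1 − a)^{−1/2})^{|N|}` (`a < 1`; the printed
  `Π_{b∈Z}(1 − O(α₅))^{−½d(𝔤)}`), by Fubini over the coordinates and `B13PerturbativeStep.gaussian_exp_sq_integral`;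
  `outer_225_le` — `≤ exp(a|N|)` for `0 ≤ a ≤ ½` (*"≦ exp(O(α₅)|Z|)"*).
* §5 **the assembly (2.23) ⇒ (2.26)'s last factor**: `integrand223_le` (pointwise in `X`: *"the zeroth order term
  cancels the first quadratic form under the first exponential in (2.23). The remainder can be estimated by
  ½O(α₅)‖ZX‖²"* — `−½⟨ΓX,CΓX⟩ + (½ + αc)⟨ΓX,CΓX⟩ ≤ αcg‖X‖²`), **`integral223_le`**: `(2.23) ≤ exp(αc|Λ|)·exp(α(1 +
  2cg)|N|)` under `α(1 + 2cg) ≤ ½`, and **`integral223_le_226`**: `≤ exp((c + 1 + 2cg)·α·|N|)` when `|Λ| ≤ |N|`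
  (`Z₀ ⊂ Z`) — the printed *"exp O(1)α₅|Z|"* with `O(1) = c + 1 + 2cg` explicit.
* §6 `integral223_eq` — *"It is a Gaussian integral, and can be easily calculated"*: after the `B`-integration,
  `(2.23) = √(det ratio) · ∫dμ₀(X) exp(½α‖X‖² + ½⟨ΓX, ((1 − αC)⁻¹C − C)ΓX⟩)` exactly (the zeroth-order term of
  `(C⁻¹ − αI)⁻¹ = (1 − αC)⁻¹C` cancelled against `−½⟨ΓX, CΓX⟩`).
* §7 **the symmetric case of (2.15)** (*"For the pair (U, 0) the operators are symmetric, and the measure is positive,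
  and then the estimates are simpler"*): at REAL operators the modulus of a normalised Gaussian mean is at most the
  mean of a majorant of the modulus (`norm_gaussMean_le`, `|∫| ≤ ∫|·|`; no measurability asked of the integrand), so a
  last line `F` with `‖F(B)‖ ≤ K·exp(½α‖B‖²)` (the shape (2.20) + (2.22) give it, rows B13.Eq2.20/2.22, `K` carrying
  `exp(−½γ₂ε₁²g_k⁻²|P|)`) has `‖∫dμ_C(B) e^{−⟨ΓX,B⟩}F(B)‖ ≤ K·innerB` (`norm_innerMean_le`) and lines 2–4 of (2.14)
  obey `‖∫dμ₀(X) e^{−½⟨ΓX,CΓX⟩} ∫dμ_C(B) e^{−⟨ΓX,B⟩}F(B)‖ ≤ K·exp(αc|Λ|)·exp(α(1 + 2cg)|N|)` (`norm_outerMean_le`).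
* §8 the same for the OBJECTS OF RECORD of (2.14) (`B13Term214.integrand214` / `cgaussMean` at real operators, which
  `B13Term214.integrand214_real` identifies with the function `G` of (2.6), `B13Sect2Statements.G26`):
  `norm_core214_real_le`.
HONEST SCOPE.  Proved: the real Gaussian computation (2.23)–(2.25) and its bound, for every positive definite `C`,
every `Γ`, every `α ≥ 0` in the printed smallness regime; and the symmetric-case route from (2.14) to that bound.
NOT proved here (hypotheses / other rows): the passage (2.15)–(2.22) at COMPLEX parameters `σ(Z)`, `(U′, J)` — the
perturbative forms `R₁, R₂, R₃` and the determinant quotients of (2.16)–(2.17) (by assertion in print, cell locus L16a;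
structural consequences in `B13PerturbativeStep`), the bounds (2.19)–(2.22) of the last line (rows B13.Eq2.19–2.22:
`B13Bound143OneShot`, `B13Resum220`, `B13.indicator_le_exp_222`), and the operator norms behind `c, g` (L17a).  The
index sets `Λ`, `N` are abstract finite types; `|Z₀| ≤ |Z|` enters `integral223_le_226` as the hypothesis `|Λ| ≤ |N|`.
Every declaration is a `def` with the printed body or a proved `theorem`; no `sorry`, no new named fact (D-0026);
statements specific to a display carry its locator, plumbing is tagged "(elementary API for (2.2x))".

v1.1 (unit `lit-balaban-r10` gen 8; APPEND-ONLY — the v1 declarations are byte-identical): §9 `norm_F214_le` — the last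
line of (2.14), `B13Term214.F214 = (−1)^{|P|}χ_{k,Y₀}χᶜ_{k,P} exp[Σ_{Y∈𝐃} τ(Y)𝐕_k(Y, ·)]`, has the shape `‖F(B)‖ ≤
K·exp(½α‖Z₀B‖²)` assumed by §7–§8 as soon as the characteristic functions obey (2.22) and the interaction obeys (2.20)
(rows B13.Eq2.20, B13.Eq2.22; both entered as hypotheses in their printed shapes): `K = exp(−½γ₂ε₁²g_k⁻²|P| + O(1)α₄M⁻⁴|Y₀|)`,
`α = γ₂ + O(1)α₄` — two of the four summands of `α₅`.

v1.2 (unit `lit-balaban-r10` gen 17; statements byte-identical, one proof body changed): `outer_225_le` re-derives the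
scalar inequality `e^{−2a} ≤ 1 − a` (`0 ≤ a ≤ ½`) inline from Mathlib's `Real.add_one_le_exp` instead of naming the
tree's `Literature.NumberTheory.LFunctions.Nicolas.exp_neg_two_mul_le`, which reached this file only through the
transitive import `B13Term214 → B13PerturbativeStep → Literature.NumberTheory.LFunctions.NicolasOmega`; this removes
the last by-name use of that number-theory module in the Bałaban corpus, so that `B13PerturbativeStep` can drop the
cross-trunk import (referee ref-3 advisory N-g45-2).
-/

noncomputable section

namespace Literature.MathematicalPhysics.QuantumFieldTheory.Balaban1983to89.B13Integral223

open Matrix MeasureTheory Finset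
open B13GaugeDevices (gaussWeight gaussInt gaussNorm gaussMean integral_linear_shift gaussInt_one_eq_gaussNorm)
open B2Eq228Conditioning (gaussNorm_eq gaussNorm_pos gaussNorm_nonneg integrable_gaussWeight)

variable {Λ N : Type} [Fintype Λ] [Fintype N] [DecidableEq Λ] [DecidableEq N]

/-! ## §1. The printed objects of (2.23) -/

/-- **The `B`-integral of (2.23)** p. 17: `∫dμ_{C^{(k)}(Z₀,0)}(B) exp(−⟨B, Γ_k(Z₀,0)X⟩ + ½α₅‖Z₀B‖²)` at the
source `J = Γ_k(Z₀,0)X`, in the model: the normalised Gaussian mean of precision `C⁻¹` (covariance `C =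
C^{(k)}(Z₀, 0)`) of `B ↦ exp(−⟨B, J⟩ + ½α‖B‖²)`. [cite: Balaban1988RG2Cluster, (2.23) p.17] -/
def innerB (C : Matrix Λ Λ ℝ) (α : ℝ) (J : Λ → ℝ) : ℝ :=
  gaussMean C⁻¹ (fun B : Λ → ℝ => Real.exp (-(B ⬝ᵥ J) + α / 2 * (B ⬝ᵥ B)))

/-- **The display (2.23)** p. 17: `∫dμ₀(X)|_Z exp(−½⟨Γ_k(Z₀,0)X, C^{(k)}(Z₀,0)Γ_k(Z₀,0)X⟩ + ½α₅‖ZX‖²) ·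
∫dμ_{C^{(k)}(Z₀,0)}(B) exp(−⟨B, Γ_k(Z₀,0)X⟩ + ½α₅‖Z₀B‖²)` — *"It is a Gaussian integral"* — as a real number, for
the covariance `C`, the operator `Γ = Γ_k(Z₀, 0)` on the coordinates `N` of `ZX`, and `α = α₅`; `dμ₀ = gaussMean 1`.
[cite: Balaban1988RG2Cluster, (2.23) p.17] -/
def integral223 (C : Matrix Λ Λ ℝ) (Γ : Matrix Λ N ℝ) (α : ℝ) : ℝ :=
  gaussMean (1 : Matrix N N ℝ) (fun X : N → ℝ =>
    Real.exp (-(1 / 2 * ((Γ *ᵥ X) ⬝ᵥ (C *ᵥ (Γ *ᵥ X)))) + α / 2 * (X ⬝ᵥ X)) * innerB C α (Γ *ᵥ X))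

/-! ## §2. Spectral preliminaries -/

/-- Spectral form of a positive definite covariance and of its inverse: `C = U·diag(λ)·U*`, `C⁻¹ = U·diag(λ⁻¹)·U*`
with `U` the (real, orthogonal) eigenvector unitary and `λ = λ_k(C) > 0` (Mathlib's spectral theorem; the pattern of
`B13PerturbativeStep.remainder_form_le`). [cite: Balaban1988RG2Cluster, (2.24) p.17] (elementary API for (2.24)) -/
theorem exists_spectral {C : Matrix Λ Λ ℝ} (hC : C.PosDef) :
    ∃ (U : Matrix Λ Λ ℝ) (ev : Λ → ℝ), ev = hC.1.eigenvalues ∧ U * star U = 1 ∧ star U * U = 1 ∧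
      C = U * diagonal ev * star U ∧ C⁻¹ = U * diagonal (fun k => (ev k)⁻¹) * star U := by
  obtain ⟨ev, hev⟩ : ∃ ev : Λ → ℝ, ev = hC.1.eigenvalues := ⟨_, rfl⟩
  obtain ⟨U, hU⟩ : ∃ U : Matrix Λ Λ ℝ, U = (hC.1.eigenvectorUnitary : Matrix Λ Λ ℝ) := ⟨_, rfl⟩
  have hpos : ∀ k, 0 < ev k := by rw [hev]; exact hC.eigenvalues_pos
  have hUU : U * star U = 1 := by rw [hU]; exact Unitary.coe_mul_star_self hC.1.eigenvectorUnitary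
  have hUU' : star U * U = 1 := by rw [hU]; exact Unitary.coe_star_mul_self hC.1.eigenvectorUnitary
  have hspec : C = U * diagonal ev * star U := by
    have h := hC.1.spectral_theorem
    rw [Unitary.conjStarAlgAut_apply, ← hU] at h
    have hD : (diagonal (RCLike.ofReal ∘ hC.1.eigenvalues) : Matrix Λ Λ ℝ) = diagonal ev := by
      rw [hev]
      ext i j
      simp only [diagonal_apply, Function.comp_apply, RCLike.ofReal_real_eq_id, id]
    rw [hD] at h
    exact h
  have hinv : C⁻¹ = U * diagonal (fun k => (ev k)⁻¹) * star U := by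
    refine Matrix.inv_eq_right_inv ?_
    rw [hspec]
    calc U * diagonal ev * star U * (U * diagonal (fun k => (ev k)⁻¹) * star U)
        = U * (diagonal ev * (star U * U) * diagonal (fun k => (ev k)⁻¹)) * star U := by
          simp only [Matrix.mul_assoc]
      _ = 1 := by
          rw [hUU', Matrix.mul_one, diagonal_mul_diagonal]
          have : (fun k => ev k * (ev k)⁻¹) = fun _ => (1 : ℝ) := funext fun k => mul_inv_cancel₀ (hpos k).ne'
          rw [this, diagonal_one, Matrix.mul_one, hUU]
  exact ⟨U, ev, hev, hUU, hUU', hspec, hinv⟩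

/-- `U*` is an isometry: `Σ_k (U*x)_k² = ‖x‖²` when `UU* = 1`. [cite: Balaban1988RG2Cluster, (2.24) p.17] (elementary API for (2.24)) -/
theorem sum_sq_star_mulVec {U : Matrix Λ Λ ℝ} (hUU : U * star U = 1) (x : Λ → ℝ) :
    ∑ k, ((star U) *ᵥ x) k ^ 2 = x ⬝ᵥ x := by
  classical
  have h := B13PerturbativeStep.dotProduct_conj_diagonal_mulVec U (fun _ => (1 : ℝ)) x
  rw [diagonal_one, Matrix.mul_one, hUU, one_mulVec] at h
  rw [h]
  exact Finset.sum_congr rfl fun k _ => (one_mul _).symm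

/-- `⟨x, C⁻¹x⟩ ≥ c⁻¹‖x‖²` when the eigenvalues of the covariance are `≤ c` (the lower bound making `C⁻¹ − α₅I`
positive for `α₅c < 1`). [cite: Balaban1988RG2Cluster, (2.24) p.17] (elementary API for (2.24)) -/
theorem inv_quadForm_ge {C : Matrix Λ Λ ℝ} (hC : C.PosDef) {c : ℝ} (hc : ∀ k, hC.1.eigenvalues k ≤ c)
    (x : Λ → ℝ) : c⁻¹ * (x ⬝ᵥ x) ≤ x ⬝ᵥ (C⁻¹ *ᵥ x) := by
  obtain ⟨U, ev, hev, hUU, -, -, hinv⟩ := exists_spectral hC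
  have hpos : ∀ k, 0 < ev k := by rw [hev]; exact hC.eigenvalues_pos
  have hc' : ∀ k, ev k ≤ c := by rw [hev]; exact hc
  rw [hinv, B13PerturbativeStep.dotProduct_conj_diagonal_mulVec, ← sum_sq_star_mulVec hUU, Finset.mul_sum]
  exact Finset.sum_le_sum fun k _ => mul_le_mul_of_nonneg_right (inv_anti₀ (hpos k) (hc' k)) (sq_nonneg _)

/-- `⟨x, Cx⟩ ≤ c‖x‖²` when the eigenvalues of `C` are `≤ c` (`c = ‖C^{(k)}(Z₀,0)‖`).
[cite: Balaban1988RG2Cluster, (2.24) p.17] (elementary API for (2.24)) -/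
theorem quadForm_le {C : Matrix Λ Λ ℝ} (hC : C.PosDef) {c : ℝ} (hc : ∀ k, hC.1.eigenvalues k ≤ c)
    (x : Λ → ℝ) : x ⬝ᵥ (C *ᵥ x) ≤ c * (x ⬝ᵥ x) := by
  obtain ⟨U, ev, hev, hUU, -, hspec, -⟩ := exists_spectral hC
  have hc' : ∀ k, ev k ≤ c := by rw [hev]; exact hc
  conv_lhs => rw [hspec]
  rw [B13PerturbativeStep.dotProduct_conj_diagonal_mulVec, ← sum_sq_star_mulVec hUU, Finset.mul_sum]
  exact Finset.sum_le_sum fun k _ => mul_le_mul_of_nonneg_right (hc' k) (sq_nonneg _)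

omit [DecidableEq N] in
/-- The hypothesis `⟨ΓX, C ΓX⟩ ≤ g‖X‖²` of the assembly below from the two printed operator norms: `λ_k(C) ≤ c`
(`‖C^{(k)}(Z₀,0)‖ ≤ c`, `c ≥ 0`) and `‖ΓX‖² ≤ γ₂‖X‖²` (`‖Γ_k(Z₀,0)‖² ≤ γ₂`) give `g = c·γ₂` — the `O(1)` operator
bounds of [13]/[15] the remainder estimate uses (by reference). [cite: Balaban1988RG2Cluster, (2.24) p.17] -/
theorem form_le_of_opNorm {C : Matrix Λ Λ ℝ} (hC : C.PosDef) {c γ₂ : ℝ} (hc0 : 0 ≤ c)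
    (hc : ∀ k, hC.1.eigenvalues k ≤ c) (Γ : Matrix Λ N ℝ)
    (hΓ2 : ∀ X : N → ℝ, (Γ *ᵥ X) ⬝ᵥ (Γ *ᵥ X) ≤ γ₂ * (X ⬝ᵥ X)) (X : N → ℝ) :
    (Γ *ᵥ X) ⬝ᵥ (C *ᵥ (Γ *ᵥ X)) ≤ c * γ₂ * (X ⬝ᵥ X) :=
  (quadForm_le hC hc _).trans (by rw [mul_assoc]; exact mul_le_mul_of_nonneg_left (hΓ2 X) hc0)

omit [DecidableEq Λ] in
/-- `0 < ‖x‖²` for `x ≠ 0`. [cite: Balaban1988RG2Cluster, (2.24) p.17] (elementary API for (2.24)) -/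
theorem dotProduct_self_pos' {x : Λ → ℝ} (hx : x ≠ 0) : 0 < x ⬝ᵥ x := by
  have h0 : 0 ≤ x ⬝ᵥ x := Finset.sum_nonneg fun i _ => mul_self_nonneg (x i)
  rcases h0.lt_or_eq with h | h
  · exact h
  · exact absurd (dotProduct_self_eq_zero.1 h.symm) hx

/-- `C⁻¹ − αI` is symmetric. [cite: Balaban1988RG2Cluster, (2.24) p.17] (elementary API for (2.24)) -/
theorem isHermitian_inv_sub_smul {C : Matrix Λ Λ ℝ} (hC : C.PosDef) (α : ℝ) :
    (C⁻¹ - α • (1 : Matrix Λ Λ ℝ)).IsHermitian := by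
  unfold Matrix.IsHermitian
  rw [conjTranspose_sub, conjTranspose_smul, conjTranspose_one, star_trivial, hC.inv.isHermitian.eq]

/-- **"Of course we have assumed that α₅ is sufficiently small, e.g. α₅‖C^{(k)}(Z₀,0)‖ < ½"** — what the assumption buys:
for `λ_k(C) ≤ c` and `αc < 1` the precision `C⁻¹ − αI` of the `B`-integral (2.24) is positive definite (so (2.24) is a
convergent Gaussian integral). [cite: Balaban1988RG2Cluster, (2.24) p.17] -/
theorem posDef_inv_sub_smul {C : Matrix Λ Λ ℝ} (hC : C.PosDef) {α c : ℝ} (hc : ∀ k, hC.1.eigenvalues k ≤ c)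
    (hαc : α * c < 1) : (C⁻¹ - α • (1 : Matrix Λ Λ ℝ)).PosDef := by
  refine posDef_iff_dotProduct_mulVec.2 ⟨isHermitian_inv_sub_smul hC α, fun x hx => ?_⟩
  have hxx : 0 < x ⬝ᵥ x := dotProduct_self_pos' hx
  obtain ⟨i, -⟩ : ∃ i, x i ≠ 0 := Function.ne_iff.1 hx
  have hcpos : 0 < c := (hC.eigenvalues_pos i).trans_le (hc i)
  have hα : α < c⁻¹ := by rw [← one_div, lt_div_iff₀ hcpos]; exact hαc
  have hq := inv_quadForm_ge hC hc x
  rw [star_trivial, sub_mulVec, smul_mulVec, one_mulVec, dotProduct_sub, dotProduct_smul, smul_eq_mul]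
  nlinarith


/-! ## §3. (2.24): the `B`-integral computed exactly -/

/-- `C⁻¹ − αI` is symmetric (transpose form, for `B13GaugeDevices.integral_linear_shift`).
[cite: Balaban1988RG2Cluster, (2.24) p.17] (elementary API for (2.24)) -/
theorem isSymm_inv_sub_smul {C : Matrix Λ Λ ℝ} (hC : C.PosDef) (α : ℝ) :
    (C⁻¹ - α • (1 : Matrix Λ Λ ℝ)).IsSymm := by
  have h := (isHermitian_inv_sub_smul hC α).eq
  rwa [conjTranspose_eq_transpose_of_trivial] at h

/-- *"including the last two quadratic forms under the exponential into the Gaussian measure"*: the weight of `dμ_C`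
times the `B`-integrand of (2.23) is the Gaussian weight of precision `C⁻¹ − αI` with the linear source `J`,
`e^{−½⟨B,C⁻¹B⟩}·e^{−⟨B,J⟩ + ½α‖B‖²} = e^{−⟨J,B⟩ − ½⟨B,(C⁻¹ − αI)B⟩}`. [cite: Balaban1988RG2Cluster, (2.24) p.17] -/
theorem weight_mul_integrand_eq (C : Matrix Λ Λ ℝ) (α : ℝ) (J B : Λ → ℝ) :
    gaussWeight C⁻¹ B • Real.exp (-(B ⬝ᵥ J) + α / 2 * (B ⬝ᵥ B))
      = Real.exp (-(J ⬝ᵥ B) - 1 / 2 * (B ⬝ᵥ ((C⁻¹ - α • (1 : Matrix Λ Λ ℝ)) *ᵥ B))) • (1 : ℝ) := by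
  rw [gaussWeight, smul_eq_mul, smul_eq_mul, mul_one, ← Real.exp_add, sub_mulVec, smul_mulVec, one_mulVec,
    dotProduct_sub, dotProduct_smul, smul_eq_mul, dotProduct_comm J B]
  congr 1
  ring

/-- The un-normalised `B`-integral: `∫dB e^{−½⟨B,C⁻¹B⟩} e^{−⟨B,J⟩ + ½α‖B‖²} = e^{½⟨J,(C⁻¹ − αI)⁻¹J⟩} · ∫dB
e^{−½⟨B,(C⁻¹ − αI)B⟩}` (the linear shift at precision `C⁻¹ − αI ≻ 0`). [cite: Balaban1988RG2Cluster, (2.24) p.17] -/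
theorem gaussInt_integrand_eq {C : Matrix Λ Λ ℝ} (hC : C.PosDef) {α : ℝ}
    (hα : (C⁻¹ - α • (1 : Matrix Λ Λ ℝ)).PosDef) (J : Λ → ℝ) :
    gaussInt C⁻¹ (fun B : Λ → ℝ => Real.exp (-(B ⬝ᵥ J) + α / 2 * (B ⬝ᵥ B)))
      = Real.exp (1 / 2 * (J ⬝ᵥ ((C⁻¹ - α • (1 : Matrix Λ Λ ℝ))⁻¹ *ᵥ J)))
          * gaussNorm (C⁻¹ - α • (1 : Matrix Λ Λ ℝ)) := by
  have h := integral_linear_shift (C⁻¹ - α • (1 : Matrix Λ Λ ℝ)) (isSymm_inv_sub_smul hC α)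
    hα.det_pos.ne'.isUnit J (fun _ => (1 : ℝ))
  rw [gaussInt_one_eq_gaussNorm, smul_eq_mul] at h
  rw [← h, gaussInt]
  exact integral_congr_ae (Filter.Eventually.of_forall fun B => weight_mul_integrand_eq C α J B)

/-- **(2.24), exactly** p. 17: *"At first we calculate the integral with respect to B, including the last two
quadratic forms under the exponential into the Gaussian measure. It is equal to `|det(C^{(k)}(Z₀,0)⁻¹)/det(C^{(k)}(Z₀,0)⁻¹
− α₅I)|^{1/2} · exp(½⟨Γ_k(Z₀,0)X, (C^{(k)}(Z₀,0)⁻¹ − α₅I)⁻¹Γ_k(Z₀,0)X⟩)`"* — for every positive definite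
covariance `C`, every `α` with `C⁻¹ − αI ≻ 0` (`posDef_inv_sub_smul`) and every source `J` (= `Γ_k(Z₀,0)X`); the
determinant ratio is positive, so the printed modulus signs are immaterial (`innerB_eq_224_abs`).
[cite: Balaban1988RG2Cluster, (2.24) p.17] -/
theorem innerB_eq_224 {C : Matrix Λ Λ ℝ} (hC : C.PosDef) {α : ℝ}
    (hα : (C⁻¹ - α • (1 : Matrix Λ Λ ℝ)).PosDef) (J : Λ → ℝ) :
    innerB C α J = Real.sqrt (C⁻¹.det / (C⁻¹ - α • (1 : Matrix Λ Λ ℝ)).det)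
      * Real.exp (1 / 2 * (J ⬝ᵥ ((C⁻¹ - α • (1 : Matrix Λ Λ ℝ))⁻¹ *ᵥ J))) := by
  rw [innerB, gaussMean, gaussInt_integrand_eq hC hα J, smul_eq_mul, gaussNorm_eq hC.inv, gaussNorm_eq hα,
    Real.sqrt_div' _ hα.det_pos.le]
  have h1 : 0 < Real.sqrt (2 * Real.pi) ^ Fintype.card Λ := pow_pos (Real.sqrt_pos.2 (by positivity)) _
  have h2 : 0 < Real.sqrt C⁻¹.det := Real.sqrt_pos.2 hC.inv.det_pos
  have h3 : 0 < Real.sqrt (C⁻¹ - α • (1 : Matrix Λ Λ ℝ)).det := Real.sqrt_pos.2 hα.det_pos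
  field_simp

/-- **(2.24) with the printed modulus signs**: `∫dμ_C(B) e^{−⟨B,J⟩ + ½α‖B‖²} = |det C⁻¹/det(C⁻¹ − αI)|^{1/2} ·
exp(½⟨J, (C⁻¹ − αI)⁻¹J⟩)` (the ratio is positive). [cite: Balaban1988RG2Cluster, (2.24) p.17] -/
theorem innerB_eq_224_abs {C : Matrix Λ Λ ℝ} (hC : C.PosDef) {α : ℝ}
    (hα : (C⁻¹ - α • (1 : Matrix Λ Λ ℝ)).PosDef) (J : Λ → ℝ) :
    innerB C α J = Real.sqrt |C⁻¹.det / (C⁻¹ - α • (1 : Matrix Λ Λ ℝ)).det|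
      * Real.exp (1 / 2 * (J ⬝ᵥ ((C⁻¹ - α • (1 : Matrix Λ Λ ℝ))⁻¹ *ᵥ J))) := by
  rw [abs_of_pos (div_pos hC.inv.det_pos hα.det_pos)]
  exact innerB_eq_224 hC hα J

/-- *"The quadratic form under the exponential is expanded with respect to α₅ … The remainder can be estimated by
½O(α₅)‖ZX‖²"*, covariance level: `⟨J, (C⁻¹ − αI)⁻¹J⟩ ≤ (1 + 2αc)⟨J, CJ⟩` for `λ_k(C) ≤ c`, `α ≥ 0`, `αc ≤ ½`
(`(C⁻¹ − αI)⁻¹ = (1 − αC)⁻¹C` and `B13PerturbativeStep.remainder_form_le`). [cite: Balaban1988RG2Cluster, (2.24) p.17] -/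
theorem form_224_le {C : Matrix Λ Λ ℝ} (hC : C.PosDef) {α c : ℝ} (hα0 : 0 ≤ α)
    (hc : ∀ k, hC.1.eigenvalues k ≤ c) (hαc : α * c ≤ 1 / 2) (J : Λ → ℝ) :
    J ⬝ᵥ ((C⁻¹ - α • (1 : Matrix Λ Λ ℝ))⁻¹ *ᵥ J) ≤ (1 + 2 * α * c) * (J ⬝ᵥ (C *ᵥ J)) := by
  rw [B13PerturbativeStep.inv_inv_sub_smul_eq hC.det_pos.ne'.isUnit α]
  have h := (B13PerturbativeStep.remainder_form_le hC hα0 hc hαc J).2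
  have hsplit : (1 - α • C)⁻¹ * C = ((1 - α • C)⁻¹ * C - C) + C := (sub_add_cancel _ _).symm
  rw [hsplit, add_mulVec, dotProduct_add]
  linarith

/-- *"The factor with the determinants can be estimated by exp O(1)α₅|Z₀|"*: `√(det C⁻¹/det(C⁻¹ − αI)) ≤
exp(αc·|Λ|)` (`|Λ| = d(𝔤)·#bonds(Z₀)`, `c = ‖C^{(k)}(Z₀,0)‖`; from `B13PerturbativeStep.det_ratio_le_exp_card`).
[cite: Balaban1988RG2Cluster, (2.24) p.17] -/
theorem sqrt_det_ratio_le {C : Matrix Λ Λ ℝ} (hC : C.PosDef) {α c : ℝ} (hα0 : 0 ≤ α)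
    (hc : ∀ k, hC.1.eigenvalues k ≤ c) (hαc : α * c ≤ 1 / 2) :
    Real.sqrt (C⁻¹.det / (C⁻¹ - α • (1 : Matrix Λ Λ ℝ)).det) ≤ Real.exp (α * c * Fintype.card Λ) := by
  have h := (B13PerturbativeStep.det_ratio_le_exp_card hC hα0 hc hαc).2
  calc Real.sqrt (C⁻¹.det / (C⁻¹ - α • (1 : Matrix Λ Λ ℝ)).det)
      ≤ Real.sqrt (Real.exp (2 * α * c * Fintype.card Λ)) := Real.sqrt_le_sqrt h
    _ = Real.exp (α * c * Fintype.card Λ) := by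
        rw [← Real.exp_half]
        ring_nf

/-- **(2.24) estimated**: `∫dμ_C(B) e^{−⟨B,J⟩ + ½α‖B‖²} ≤ exp(αc|Λ|) · exp((½ + αc)⟨J, CJ⟩)` for `λ_k(C) ≤ c`, `α ≥ 0`,
`αc ≤ ½` — the determinant factor `exp O(1)α₅|Z₀|` times the zeroth-order term `exp ½⟨J, CJ⟩` times the remainder
`exp αc⟨J, CJ⟩`. [cite: Balaban1988RG2Cluster, (2.24) p.17] -/
theorem innerB_le {C : Matrix Λ Λ ℝ} (hC : C.PosDef) {α c : ℝ} (hα0 : 0 ≤ α)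
    (hc : ∀ k, hC.1.eigenvalues k ≤ c) (hαc : α * c ≤ 1 / 2) (J : Λ → ℝ) :
    innerB C α J ≤ Real.exp (α * c * Fintype.card Λ) * Real.exp ((1 / 2 + α * c) * (J ⬝ᵥ (C *ᵥ J))) := by
  have hα : (C⁻¹ - α • (1 : Matrix Λ Λ ℝ)).PosDef := posDef_inv_sub_smul hC hc (by linarith)
  rw [innerB_eq_224 hC hα J]
  refine mul_le_mul (sqrt_det_ratio_le hC hα0 hc hαc) (Real.exp_le_exp.2 ?_) (Real.exp_pos _).le
    (Real.exp_pos _).le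
  have h := form_224_le hC hα0 hc hαc J
  linarith

/-- The `B`-integral of (2.23) is non-negative (a normalised mean of a positive function; junk `0` included).
[cite: Balaban1988RG2Cluster, (2.23) p.17] (elementary API for (2.23)) -/
theorem innerB_nonneg (C : Matrix Λ Λ ℝ) (α : ℝ) (J : Λ → ℝ) : 0 ≤ innerB C α J := by
  rw [innerB, gaussMean, smul_eq_mul]
  refine mul_nonneg (inv_nonneg.2 (gaussNorm_nonneg _)) (integral_nonneg fun B => ?_)
  simp only [Pi.zero_apply, smul_eq_mul]
  exact mul_nonneg (Real.exp_pos _).le (Real.exp_pos _).le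


/-! ## §4. (2.25): the `X`-integral -/

/-- The normalisation of `dμ₀`: `∫dX e^{−½‖X‖²} = √(2π)^{|N|}` (also `B13Sect2Statements.gaussNorm_one`; here from
`B2Eq228Conditioning.gaussNorm_eq`). [cite: Balaban1988RG2Cluster, (2.25) p.17] (elementary API for (2.25)) -/
theorem gaussNorm_one_eq : gaussNorm (1 : Matrix N N ℝ) = Real.sqrt (2 * Real.pi) ^ Fintype.card N := by
  classical
  rw [gaussNorm_eq Matrix.PosDef.one, det_one, Real.sqrt_one, div_one]

/-- The integrand of (2.25) against `dμ₀` factorises over the coordinates: `e^{−½‖X‖²} e^{½a‖X‖²} = Π_i e^{−½X_i²}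
e^{½aX_i²}` (the printed *"Π_{b∈Z}"*). [cite: Balaban1988RG2Cluster, (2.25) p.17] (elementary API for (2.25)) -/
theorem weight_one_mul_exp_sq (a : ℝ) (X : N → ℝ) :
    gaussWeight (1 : Matrix N N ℝ) X • Real.exp (a / 2 * (X ⬝ᵥ X))
      = ∏ i, (Real.exp (-(1 / 2) * X i ^ 2) * Real.exp (a / 2 * X i ^ 2)) := by
  rw [gaussWeight, one_mulVec, smul_eq_mul, Finset.prod_mul_distrib, ← Real.exp_sum, ← Real.exp_sum]
  congr 2
  · rw [dotProduct, Finset.mul_sum, ← Finset.sum_neg_distrib]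
    exact Finset.sum_congr rfl fun i _ => by ring
  · rw [dotProduct, Finset.mul_sum]
    exact Finset.sum_congr rfl fun i _ => by ring

/-- **(2.25), the equality** p. 17: `∫dμ₀(X)|_Z exp ½a‖ZX‖² = Π_{b∈Z}(1 − a)^{−½d(𝔤)}`, i.e. `= ((1 − a)^{−1/2})^{|N|}`
over the `|N| = d(𝔤)·#bonds(Z)` real coordinates, for every `a < 1` (Fubini over the coordinates and the one-dimensional
`B13PerturbativeStep.gaussian_exp_sq_integral`; the print omits the sign of the exponent, DIVERGENCE D-b13.13).
[cite: Balaban1988RG2Cluster, (2.25) p.17] -/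
theorem outer_225_eq {a : ℝ} (ha : a < 1) :
    gaussMean (1 : Matrix N N ℝ) (fun X : N → ℝ => Real.exp (a / 2 * (X ⬝ᵥ X)))
      = ((Real.sqrt (1 - a))⁻¹) ^ Fintype.card N := by
  rw [gaussMean, gaussNorm_one_eq, gaussInt, smul_eq_mul]
  simp_rw [weight_one_mul_exp_sq]
  rw [integral_fintype_prod_volume_eq_pow
      (fun t : ℝ => Real.exp (-(1 / 2) * t ^ 2) * Real.exp (a / 2 * t ^ 2)),
    ← B13PerturbativeStep.gaussian_exp_sq_integral ha, div_pow, inv_mul_eq_div]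

/-- **(2.25), the inequality** p. 17: `∫dμ₀(X)|_Z exp ½a‖ZX‖² ≦ exp(a|N|)` (*"≦ exp(O(α₅)|Z|)"*) for `0 ≤ a ≤ ½`
(`(1 − a)^{−1/2} ≤ e^{a}` from `e^{−2a} ≤ 1 − a`, i.e. `1 + 2a ≤ e^{2a}` and `(1 + 2a)(1 − a) ≥ 1`, re-derived inline
from Mathlib's `Real.add_one_le_exp`). [cite: Balaban1988RG2Cluster, (2.25) p.17] -/
theorem outer_225_le {a : ℝ} (h0 : 0 ≤ a) (h1 : a ≤ 1 / 2) :
    gaussMean (1 : Matrix N N ℝ) (fun X : N → ℝ => Real.exp (a / 2 * (X ⬝ᵥ X)))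
      ≤ Real.exp (a * Fintype.card N) := by
  rw [outer_225_eq (by linarith)]
  have hstep : (Real.sqrt (1 - a))⁻¹ ≤ Real.exp a := by
    have hna : Real.exp (-(2 * a)) ≤ 1 - a := by
      have he : 2 * a + 1 ≤ Real.exp (2 * a) := Real.add_one_le_exp _
      rw [Real.exp_neg, inv_le_iff_one_le_mul₀ (Real.exp_pos _)]
      nlinarith [mul_nonneg h0 (show 0 ≤ 1 - 2 * a by linarith)]
    have hsq : Real.exp (-(2 * a)) = Real.exp (-a) ^ 2 := by
      rw [sq, ← Real.exp_add]
      ring_nf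
    have h2 : Real.exp (-a) ≤ Real.sqrt (1 - a) := by
      have h3 := Real.sqrt_le_sqrt hna
      rwa [hsq, Real.sqrt_sq (Real.exp_pos _).le] at h3
    calc (Real.sqrt (1 - a))⁻¹ ≤ (Real.exp (-a))⁻¹ := inv_anti₀ (Real.exp_pos _) h2
      _ = Real.exp a := by rw [Real.exp_neg, inv_inv]
  calc ((Real.sqrt (1 - a))⁻¹) ^ Fintype.card N ≤ (Real.exp a) ^ Fintype.card N :=
        pow_le_pow_left₀ (inv_nonneg.2 (Real.sqrt_nonneg _)) hstep _
    _ = Real.exp (a * Fintype.card N) := by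
        rw [← Real.exp_nat_mul]
        ring_nf

/-! ## §5. Assembly: (2.23) ⇒ exp O(1)α₅|Z₀| · exp O(α₅)|Z| -/

omit [DecidableEq N] in
/-- Constants come out of a Gaussian mean. [cite: Balaban1988RG2Cluster, (2.23) p.17] (elementary API for (2.23)) -/
theorem gaussMean_const_mul (A : Matrix N N ℝ) (k : ℝ) (f : (N → ℝ) → ℝ) :
    gaussMean A (fun X => k * f X) = k * gaussMean A f := by
  rw [gaussMean, gaussMean, gaussInt, gaussInt, smul_eq_mul, smul_eq_mul]
  simp_rw [smul_eq_mul, mul_left_comm _ k, integral_const_mul]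
  ring

/-- Monotonicity of `dμ₀` for a non-negative integrand under a majorant that is integrable against the weight (no
measurability asked of the minorant: a non-integrable minorant has junk mean `0`).
[cite: Balaban1988RG2Cluster, (2.25) p.17] (elementary API for (2.25)) -/
theorem gaussMean_one_mono {f g : (N → ℝ) → ℝ} (hf0 : ∀ X, 0 ≤ f X) (hfg : ∀ X, f X ≤ g X)
    (hg : Integrable (fun X => gaussWeight (1 : Matrix N N ℝ) X * g X)) :
    gaussMean (1 : Matrix N N ℝ) f ≤ gaussMean (1 : Matrix N N ℝ) g := by
  rw [gaussMean, gaussMean, gaussInt, gaussInt, smul_eq_mul, smul_eq_mul]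
  refine mul_le_mul_of_nonneg_left ?_ (inv_nonneg.2 (gaussNorm_nonneg _))
  simp_rw [smul_eq_mul]
  refine integral_mono_of_nonneg (Filter.Eventually.of_forall fun X => ?_) hg
    (Filter.Eventually.of_forall fun X => ?_)
  · exact mul_nonneg (Real.exp_pos _).le (hf0 X)
  · exact mul_le_mul_of_nonneg_left (hfg X) (Real.exp_pos _).le

/-- The majorant of (2.25) is integrable against `dμ₀`: `e^{−½‖X‖²}·k·e^{½a‖X‖²} = k·e^{−½(1 − a)‖X‖²}`, `a < 1`
(the Gaussian weight of the positive definite precision `(1 − a)I`, `B2Eq228Conditioning.integrable_gaussWeight`).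
[cite: Balaban1988RG2Cluster, (2.25) p.17] (elementary API for (2.25)) -/
theorem integrable_weight_one_mul_exp_sq {a : ℝ} (ha : a < 1) (k : ℝ) :
    Integrable (fun X : N → ℝ => gaussWeight (1 : Matrix N N ℝ) X * (k * Real.exp (a / 2 * (X ⬝ᵥ X)))) := by
  have hPD : ((1 - a) • (1 : Matrix N N ℝ)).PosDef := by
    rw [smul_one_eq_diagonal]
    exact Matrix.PosDef.diagonal fun _ => by linarith
  have h := (integrable_gaussWeight hPD).const_mul k
  refine h.congr (Filter.Eventually.of_forall fun X => ?_)
  simp only [gaussWeight, smul_mulVec, one_mulVec, dotProduct_smul, smul_eq_mul]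
  rw [mul_left_comm (Real.exp (-(1 / 2 * X ⬝ᵥ X))) k (Real.exp (a / 2 * X ⬝ᵥ X)), ← Real.exp_add]
  congr 2
  ring

omit [DecidableEq N] in
/-- **The pointwise step (2.23) → (2.25)** p. 17: *"the zeroth order term cancels the first quadratic form under
the first exponential in (2.23). The remainder can be estimated by ½O(α₅)‖ZX‖²"* — for every `X`,
`exp(−½⟨ΓX, CΓX⟩ + ½α‖X‖²) · [B-integral at J = ΓX] ≤ exp(αc|Λ|) · exp(½·α(1 + 2cg)·‖X‖²)`, given `λ_k(C) ≤ c`,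
`0 ≤ c`, `α ≥ 0`, `αc ≤ ½` and `⟨ΓX, CΓX⟩ ≤ g‖X‖²` (so `O(α₅) = α₅(1 + 2cg)`). [cite: Balaban1988RG2Cluster, (2.23)–(2.25) p.17] -/
theorem integrand223_le {C : Matrix Λ Λ ℝ} (hC : C.PosDef) (Γ : Matrix Λ N ℝ) {α c g : ℝ} (hα0 : 0 ≤ α)
    (hc0 : 0 ≤ c) (hc : ∀ k, hC.1.eigenvalues k ≤ c) (hαc : α * c ≤ 1 / 2)
    (hΓ : ∀ X : N → ℝ, (Γ *ᵥ X) ⬝ᵥ (C *ᵥ (Γ *ᵥ X)) ≤ g * (X ⬝ᵥ X)) (X : N → ℝ) :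
    Real.exp (-(1 / 2 * ((Γ *ᵥ X) ⬝ᵥ (C *ᵥ (Γ *ᵥ X)))) + α / 2 * (X ⬝ᵥ X)) * innerB C α (Γ *ᵥ X)
      ≤ Real.exp (α * c * Fintype.card Λ) * Real.exp (α * (1 + 2 * c * g) / 2 * (X ⬝ᵥ X)) := by
  have h1 := innerB_le hC hα0 hc hαc (Γ *ᵥ X)
  have hQ := hΓ X
  have hαcQ : α * c * ((Γ *ᵥ X) ⬝ᵥ (C *ᵥ (Γ *ᵥ X))) ≤ α * c * (g * (X ⬝ᵥ X)) :=
    mul_le_mul_of_nonneg_left hQ (mul_nonneg hα0 hc0)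
  calc Real.exp (-(1 / 2 * ((Γ *ᵥ X) ⬝ᵥ (C *ᵥ (Γ *ᵥ X)))) + α / 2 * (X ⬝ᵥ X)) * innerB C α (Γ *ᵥ X)
      ≤ Real.exp (-(1 / 2 * ((Γ *ᵥ X) ⬝ᵥ (C *ᵥ (Γ *ᵥ X)))) + α / 2 * (X ⬝ᵥ X))
          * (Real.exp (α * c * Fintype.card Λ)
            * Real.exp ((1 / 2 + α * c) * ((Γ *ᵥ X) ⬝ᵥ (C *ᵥ (Γ *ᵥ X))))) :=
        mul_le_mul_of_nonneg_left h1 (Real.exp_pos _).le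
    _ = Real.exp (α * c * Fintype.card Λ)
          * Real.exp (α / 2 * (X ⬝ᵥ X) + α * c * ((Γ *ᵥ X) ⬝ᵥ (C *ᵥ (Γ *ᵥ X)))) := by
        rw [mul_left_comm, ← Real.exp_add]
        congr 2
        ring
    _ ≤ Real.exp (α * c * Fintype.card Λ) * Real.exp (α * (1 + 2 * c * g) / 2 * (X ⬝ᵥ X)) := by
        refine mul_le_mul_of_nonneg_left (Real.exp_le_exp.2 ?_) (Real.exp_pos _).le
        nlinarith

/-- **(2.23) bounded: *"These calculations and estimates yield"* (2.25)** — `(2.23) ≤ exp(αc·|Λ|) · exp(α(1 +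
2cg)·|N|)` = `exp O(1)α₅|Z₀| · exp O(α₅)|Z|`, for a positive definite covariance with `λ_k(C) ≤ c`, `0 ≤ c`,
`⟨ΓX, CΓX⟩ ≤ g‖X‖²` (`0 ≤ g`), `α ≥ 0`, `αc ≤ ½` and `α(1 + 2cg) ≤ ½` (the smallness under which the printed
`(1 − O(α₅))^{−½d(𝔤)} ≤ exp O(α₅)` holds). [cite: Balaban1988RG2Cluster, (2.23)–(2.25) p.17] -/
theorem integral223_le {C : Matrix Λ Λ ℝ} (hC : C.PosDef) (Γ : Matrix Λ N ℝ) {α c g : ℝ} (hα0 : 0 ≤ α)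
    (hc0 : 0 ≤ c) (hc : ∀ k, hC.1.eigenvalues k ≤ c) (hαc : α * c ≤ 1 / 2) (hg : 0 ≤ g)
    (hΓ : ∀ X : N → ℝ, (Γ *ᵥ X) ⬝ᵥ (C *ᵥ (Γ *ᵥ X)) ≤ g * (X ⬝ᵥ X))
    (ha : α * (1 + 2 * c * g) ≤ 1 / 2) :
    integral223 C Γ α
      ≤ Real.exp (α * c * Fintype.card Λ) * Real.exp (α * (1 + 2 * c * g) * Fintype.card N) := by
  have ha0 : 0 ≤ α * (1 + 2 * c * g) := mul_nonneg hα0 (by positivity)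
  rw [integral223]
  calc gaussMean (1 : Matrix N N ℝ) (fun X : N → ℝ =>
          Real.exp (-(1 / 2 * ((Γ *ᵥ X) ⬝ᵥ (C *ᵥ (Γ *ᵥ X)))) + α / 2 * (X ⬝ᵥ X)) * innerB C α (Γ *ᵥ X))
      ≤ gaussMean (1 : Matrix N N ℝ) (fun X : N → ℝ =>
          Real.exp (α * c * Fintype.card Λ) * Real.exp (α * (1 + 2 * c * g) / 2 * (X ⬝ᵥ X))) :=
        gaussMean_one_mono (fun X => mul_nonneg (Real.exp_pos _).le (innerB_nonneg C α _))
          (integrand223_le hC Γ hα0 hc0 hc hαc hΓ) (integrable_weight_one_mul_exp_sq (by linarith) _)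
    _ = Real.exp (α * c * Fintype.card Λ)
          * gaussMean (1 : Matrix N N ℝ) (fun X : N → ℝ => Real.exp (α * (1 + 2 * c * g) / 2 * (X ⬝ᵥ X))) :=
        gaussMean_const_mul _ _ _
    _ ≤ Real.exp (α * c * Fintype.card Λ) * Real.exp (α * (1 + 2 * c * g) * Fintype.card N) :=
        mul_le_mul_of_nonneg_left (outer_225_le ha0 ha) (Real.exp_pos _).le

/-- **The last factor of (2.26), `exp O(1)α₅|Z|`** p. 17: since `Z₀ ⊂ Z` (here: `|Λ| ≤ |N|`), `(2.23) ≤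
exp((c + 1 + 2cg)·α·|N|)` — the determinant factor `exp O(1)α₅|Z₀|` absorbed, `O(1) = c + 1 + 2cg` explicit (*"it is
possible to get a better bound, e.g. with |Z₀| instead of |Z| … by more careful estimates of the quadratic forms"* is
not pursued, as in print). [cite: Balaban1988RG2Cluster, (2.26) p.17] -/
theorem integral223_le_226 {C : Matrix Λ Λ ℝ} (hC : C.PosDef) (Γ : Matrix Λ N ℝ) {α c g : ℝ} (hα0 : 0 ≤ α)
    (hc0 : 0 ≤ c) (hc : ∀ k, hC.1.eigenvalues k ≤ c) (hαc : α * c ≤ 1 / 2) (hg : 0 ≤ g)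
    (hΓ : ∀ X : N → ℝ, (Γ *ᵥ X) ⬝ᵥ (C *ᵥ (Γ *ᵥ X)) ≤ g * (X ⬝ᵥ X))
    (ha : α * (1 + 2 * c * g) ≤ 1 / 2) (hcard : Fintype.card Λ ≤ Fintype.card N) :
    integral223 C Γ α ≤ Real.exp ((c + 1 + 2 * c * g) * α * Fintype.card N) := by
  refine (integral223_le hC Γ hα0 hc0 hc hαc hg hΓ ha).trans ?_
  rw [← Real.exp_add]
  refine Real.exp_le_exp.2 ?_
  have h1 : α * c * (Fintype.card Λ : ℝ) ≤ α * c * (Fintype.card N : ℝ) :=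
    mul_le_mul_of_nonneg_left (Nat.cast_le.2 hcard) (mul_nonneg hα0 hc0)
  nlinarith


/-! ## §6. (2.23) computed: the `B`-integration done, the zeroth-order term cancelled -/

/-- **(2.23) after the `B`-integration, exactly** (*"It is a Gaussian integral, and can be easily calculated"*): for
`C ≻ 0` and `C⁻¹ − αI ≻ 0`, `(2.23) = √(det C⁻¹/det(C⁻¹ − αI)) · ∫dμ₀(X) exp(½α‖X‖² + ½⟨ΓX, ((1 − αC)⁻¹C − C)ΓX⟩)`
— (2.24) inserted, `(C⁻¹ − αI)⁻¹ = (1 − αC)⁻¹C` expanded, and *"the zeroth order term cancels the first quadratic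
form under the first exponential in (2.23)"*; the remainder form is `B13PerturbativeStep.remainder_form_le`'s.
[cite: Balaban1988RG2Cluster, (2.23)–(2.24) p.17] -/
theorem integral223_eq {C : Matrix Λ Λ ℝ} (hC : C.PosDef) {α : ℝ} (hα : (C⁻¹ - α • (1 : Matrix Λ Λ ℝ)).PosDef)
    (Γ : Matrix Λ N ℝ) :
    integral223 C Γ α = Real.sqrt (C⁻¹.det / (C⁻¹ - α • (1 : Matrix Λ Λ ℝ)).det)
      * gaussMean (1 : Matrix N N ℝ) (fun X : N → ℝ => Real.exp (α / 2 * (X ⬝ᵥ X)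
          + 1 / 2 * ((Γ *ᵥ X) ⬝ᵥ ((((1 : Matrix Λ Λ ℝ) - α • C)⁻¹ * C - C) *ᵥ (Γ *ᵥ X))))) := by
  rw [integral223, ← gaussMean_const_mul]
  congr 1
  funext X
  rw [innerB_eq_224 hC hα, B13PerturbativeStep.inv_inv_sub_smul_eq hC.det_pos.ne'.isUnit α, mul_left_comm,
    ← Real.exp_add, sub_mulVec, dotProduct_sub]
  congr 2
  ring

/-! ## §7. The symmetric case of (2.15) ⇒ (2.23): real operators, positive measure -/

/-- The `B`-integrand of (2.23) is integrable against the weight of `dμ_C` when `C⁻¹ − αI ≻ 0` (its integral was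
computed to be a positive number in `gaussInt_integrand_eq`, and a non-integrable function has junk integral `0`).
[cite: Balaban1988RG2Cluster, (2.24) p.17] (elementary API for (2.24)) -/
theorem integrable_weight_mul_integrand {C : Matrix Λ Λ ℝ} (hC : C.PosDef) {α : ℝ}
    (hα : (C⁻¹ - α • (1 : Matrix Λ Λ ℝ)).PosDef) (J : Λ → ℝ) :
    Integrable (fun B : Λ → ℝ => gaussWeight C⁻¹ B * Real.exp (-(B ⬝ᵥ J) + α / 2 * (B ⬝ᵥ B))) := by
  by_contra h
  have hval := gaussInt_integrand_eq hC hα J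
  rw [gaussInt] at hval
  simp_rw [smul_eq_mul] at hval
  rw [integral_undef h] at hval
  have hpos : 0 < Real.exp (1 / 2 * (J ⬝ᵥ ((C⁻¹ - α • (1 : Matrix Λ Λ ℝ))⁻¹ *ᵥ J)))
      * gaussNorm (C⁻¹ - α • (1 : Matrix Λ Λ ℝ)) := mul_pos (Real.exp_pos _) (gaussNorm_pos hα)
  exact hpos.ne' hval.symm

omit [DecidableEq Λ] in
/-- **The symmetric case of (2.15)** p. 15 (*"For the pair (U, 0) the operators are symmetric, and the measure is
positive, and then the estimates are simpler"*): at a REAL precision the modulus of a normalised Gaussian mean of a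
complex integrand is at most the mean of any majorant of its modulus that is integrable against the weight —
`‖∫dμ(B)Ψ(B)‖ ≤ ∫dμ(B) g(B)` for `‖Ψ‖ ≤ g` (`|∫| ≤ ∫|·|`; nothing is asked of `Ψ`).
[cite: Balaban1988RG2Cluster, (2.15) p.15] -/
theorem norm_gaussMean_le (A : Matrix Λ Λ ℝ) (Ψ : (Λ → ℝ) → ℂ) (g : (Λ → ℝ) → ℝ)
    (hΨ : ∀ B, ‖Ψ B‖ ≤ g B) (hg : Integrable (fun B => gaussWeight A B * g B)) :
    ‖gaussMean A Ψ‖ ≤ gaussMean A g := by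
  rw [gaussMean, gaussMean, gaussInt, gaussInt, norm_smul, smul_eq_mul, Real.norm_eq_abs,
    abs_of_nonneg (inv_nonneg.2 (gaussNorm_nonneg A))]
  refine mul_le_mul_of_nonneg_left ?_ (inv_nonneg.2 (gaussNorm_nonneg A))
  refine (norm_integral_le_integral_norm _).trans ?_
  simp_rw [smul_eq_mul]
  refine integral_mono_of_nonneg (Filter.Eventually.of_forall fun B => norm_nonneg _) hg
    (Filter.Eventually.of_forall fun B => ?_)
  show ‖gaussWeight A B • Ψ B‖ ≤ gaussWeight A B * g B
  have hw : 0 < gaussWeight A B := Real.exp_pos _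
  rw [Complex.real_smul, norm_mul, Complex.norm_real, Real.norm_eq_abs, abs_of_nonneg hw.le]
  exact mul_le_mul_of_nonneg_left (hΨ B) hw.le

/-- **The `B`-integral of (2.14) in the symmetric case is bounded by the `B`-integral of (2.23)**: if the last line
`F` of (2.14) obeys `‖F(B)‖ ≤ K·exp(½α‖B‖²)` (the shape the estimates (2.20), (2.22) produce, with `K` carrying
`exp(−½γ₂ε₁²g_k⁻²|P|)` and the `|Y₀|`-factor), then `‖∫dμ_C(B) e^{−⟨J,B⟩}F(B)‖ ≤ K · ∫dμ_C(B) e^{−⟨B,J⟩ + ½α‖B‖²}`,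
for `λ_k(C) ≤ c`, `αc ≤ ½`. [cite: Balaban1988RG2Cluster, (2.15) p.15, (2.23) p.17] -/
theorem norm_innerMean_le {C : Matrix Λ Λ ℝ} (hC : C.PosDef) {α c : ℝ}
    (hc : ∀ k, hC.1.eigenvalues k ≤ c) (hαc : α * c ≤ 1 / 2) (F : (Λ → ℝ) → ℂ) {K : ℝ}
    (hF : ∀ B, ‖F B‖ ≤ K * Real.exp (α / 2 * (B ⬝ᵥ B))) (J : Λ → ℝ) :
    ‖gaussMean C⁻¹ (fun B : Λ → ℝ => Real.exp (-(J ⬝ᵥ B)) • F B)‖ ≤ K * innerB C α J := by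
  have hα : (C⁻¹ - α • (1 : Matrix Λ Λ ℝ)).PosDef := posDef_inv_sub_smul hC hc (by linarith)
  have h := norm_gaussMean_le C⁻¹ (fun B : Λ → ℝ => Real.exp (-(J ⬝ᵥ B)) • F B)
    (fun B => K * Real.exp (-(B ⬝ᵥ J) + α / 2 * (B ⬝ᵥ B))) (fun B => ?_) ?_
  · rw [gaussMean_const_mul] at h
    exact h
  · rw [Complex.real_smul, norm_mul, Complex.norm_real, Real.norm_eq_abs, abs_of_nonneg (Real.exp_pos _).le,
      Real.exp_add, dotProduct_comm J B, mul_left_comm]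
    exact mul_le_mul_of_nonneg_left (hF B) (Real.exp_pos _).le
  · have hi := (integrable_weight_mul_integrand hC hα J).const_mul K
    refine hi.congr (Filter.Eventually.of_forall fun B => ?_)
    simp only
    ring


omit [DecidableEq Λ] in
/-- `0 ≤ ‖x‖²`. [cite: Balaban1988RG2Cluster, (2.23) p.17] (elementary API for (2.23)) -/
theorem dotProduct_self_nonneg' (x : Λ → ℝ) : 0 ≤ x ⬝ᵥ x := Finset.sum_nonneg fun i _ => mul_self_nonneg (x i)

/-- **The symmetric case, assembled** (p. 15 *"then the estimates are simpler"* + p. 17): lines 2–4 of (2.14) at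
real operators — `∫dμ₀(X) e^{−½⟨ΓX, CΓX⟩} · ∫dμ_C(B) e^{−⟨ΓX, B⟩} F(B)` with `‖F(B)‖ ≤ K·e^{½α‖B‖²}` — have modulus
`≤ K · exp(αc|Λ|) · exp(α(1 + 2cg)|N|)` = `K · exp O(1)α₅|Z₀| · exp O(α₅)|Z|`, under the hypotheses of
`integral223_le` (pointwise the integrand is bounded by `K ×` the integrand of (2.23), since `e^{½α‖X‖²} ≥ 1`).
[cite: Balaban1988RG2Cluster, (2.15) p.15, (2.23)–(2.26) p.17] -/
theorem norm_outerMean_le {C : Matrix Λ Λ ℝ} (hC : C.PosDef) (Γ : Matrix Λ N ℝ) {α c g K : ℝ} (hα0 : 0 ≤ α)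
    (hc0 : 0 ≤ c) (hc : ∀ k, hC.1.eigenvalues k ≤ c) (hαc : α * c ≤ 1 / 2) (hg : 0 ≤ g)
    (hΓ : ∀ X : N → ℝ, (Γ *ᵥ X) ⬝ᵥ (C *ᵥ (Γ *ᵥ X)) ≤ g * (X ⬝ᵥ X)) (ha : α * (1 + 2 * c * g) ≤ 1 / 2)
    (hK : 0 ≤ K) (F : (Λ → ℝ) → ℂ) (hF : ∀ B, ‖F B‖ ≤ K * Real.exp (α / 2 * (B ⬝ᵥ B))) :
    ‖gaussMean (1 : Matrix N N ℝ) (fun X : N → ℝ =>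
        Real.exp (-(1 / 2 * ((Γ *ᵥ X) ⬝ᵥ (C *ᵥ (Γ *ᵥ X)))))
          • gaussMean C⁻¹ (fun B : Λ → ℝ => Real.exp (-((Γ *ᵥ X) ⬝ᵥ B)) • F B))‖
      ≤ K * (Real.exp (α * c * Fintype.card Λ) * Real.exp (α * (1 + 2 * c * g) * Fintype.card N)) := by
  have ha0 : 0 ≤ α * (1 + 2 * c * g) := mul_nonneg hα0 (by positivity)
  have h := norm_gaussMean_le (1 : Matrix N N ℝ) (fun X : N → ℝ =>
      Real.exp (-(1 / 2 * ((Γ *ᵥ X) ⬝ᵥ (C *ᵥ (Γ *ᵥ X)))))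
        • gaussMean C⁻¹ (fun B : Λ → ℝ => Real.exp (-((Γ *ᵥ X) ⬝ᵥ B)) • F B))
    (fun X => (K * Real.exp (α * c * Fintype.card Λ)) * Real.exp (α * (1 + 2 * c * g) / 2 * (X ⬝ᵥ X)))
    (fun X => ?_) (integrable_weight_one_mul_exp_sq (by linarith) _)
  · refine h.trans ?_
    rw [gaussMean_const_mul, mul_assoc]
    exact mul_le_mul_of_nonneg_left (mul_le_mul_of_nonneg_left (outer_225_le ha0 ha) (Real.exp_pos _).le) hK
  · have hQ0 : 0 < Real.exp (-(1 / 2 * ((Γ *ᵥ X) ⬝ᵥ (C *ᵥ (Γ *ᵥ X))))) := Real.exp_pos _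
    rw [Complex.real_smul, norm_mul, Complex.norm_real, Real.norm_eq_abs, abs_of_nonneg hQ0.le]
    have h1 := norm_innerMean_le hC hc hαc F hF (Γ *ᵥ X)
    have h2 := integrand223_le hC Γ hα0 hc0 hc hαc hΓ X
    have hx : Real.exp (-(1 / 2 * ((Γ *ᵥ X) ⬝ᵥ (C *ᵥ (Γ *ᵥ X)))))
        ≤ Real.exp (-(1 / 2 * ((Γ *ᵥ X) ⬝ᵥ (C *ᵥ (Γ *ᵥ X)))) + α / 2 * (X ⬝ᵥ X)) :=
      Real.exp_le_exp.2 (le_add_of_nonneg_right (mul_nonneg (by linarith) (dotProduct_self_nonneg' X)))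
    calc Real.exp (-(1 / 2 * ((Γ *ᵥ X) ⬝ᵥ (C *ᵥ (Γ *ᵥ X)))))
          * ‖gaussMean C⁻¹ (fun B : Λ → ℝ => Real.exp (-((Γ *ᵥ X) ⬝ᵥ B)) • F B)‖
        ≤ Real.exp (-(1 / 2 * ((Γ *ᵥ X) ⬝ᵥ (C *ᵥ (Γ *ᵥ X))))) * (K * innerB C α (Γ *ᵥ X)) :=
          mul_le_mul_of_nonneg_left h1 hQ0.le
      _ ≤ Real.exp (-(1 / 2 * ((Γ *ᵥ X) ⬝ᵥ (C *ᵥ (Γ *ᵥ X)))) + α / 2 * (X ⬝ᵥ X))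
            * (K * innerB C α (Γ *ᵥ X)) :=
          mul_le_mul_of_nonneg_right hx (mul_nonneg hK (innerB_nonneg C α _))
      _ = K * (Real.exp (-(1 / 2 * ((Γ *ᵥ X) ⬝ᵥ (C *ᵥ (Γ *ᵥ X)))) + α / 2 * (X ⬝ᵥ X))
            * innerB C α (Γ *ᵥ X)) := by ring
      _ ≤ K * (Real.exp (α * c * Fintype.card Λ) * Real.exp (α * (1 + 2 * c * g) / 2 * (X ⬝ᵥ X))) :=
          mul_le_mul_of_nonneg_left h2 hK
      _ = K * Real.exp (α * c * Fintype.card Λ) * Real.exp (α * (1 + 2 * c * g) / 2 * (X ⬝ᵥ X)) := by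
          ring

/-! ## §8. The objects of record of (2.14) (`B13Term214`) at real operators -/

section Record

open B13Sect2Statements (G26 gamma26)
open B13Term214 (cgaussMean integrand214 Gamma214 integrand214_real cgaussMean_real)

variable {C₀ : Type} [Fintype C₀] [DecidableEq C₀]

omit [DecidableEq Λ] [DecidableEq C₀] in
/-- The source `Γ X = Z₀C*Δ_kCZ₀ᶜ(C^{(k)})^{1/2}X` of (2.6)/(2.14) (`B13Sect2Statements.gamma26 M T X`) is the action
of the matrix `M·(Z₀ᶜ-rows of T)` on `X`. [cite: Balaban1988RG2Cluster, (2.14) p.15] (elementary API for (2.14)) -/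
theorem gamma26_eq_mulVec (M : Matrix Λ C₀ ℝ) (T : Matrix (Λ ⊕ C₀) (Λ ⊕ C₀) ℝ) (X : Λ ⊕ C₀ → ℝ) :
    gamma26 M T X = (M * T.submatrix Sum.inr id) *ᵥ X := by
  rw [← mulVec_mulVec]
  rfl

/-- **The symmetric case for the objects of record of (2.14).**  At REAL operators — precision `A = C^{(k)}(Z₀)⁻¹`
(positive definite), block `M = Z₀C*Δ_kCZ₀ᶜ`, `T = (C^{(k)})^{1/2}`, all real, i.e. the pair `(U, 0)` and `σ(Z)`
real — the `X`-integral of lines 2–4 of (2.14), `B13Term214.cgaussMean 1 (B13Term214.integrand214 A Γ_k F)` (by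
`B13Term214.integrand214_real` the `dμ₀`-mean of the function `G` of (2.6)), has modulus `≤ K·exp(αc·|Λ|)·exp(α(1 +
2cg)·|Λ ⊕ C₀|)` whenever the last line obeys `‖F(B)‖ ≤ K e^{½α‖B‖²}`, the covariance `C^{(k)}(Z₀) = A⁻¹` has
eigenvalues `≤ c` with `αc ≤ ½`, `⟨ΓX, A⁻¹ΓX⟩ ≤ g‖X‖²`, and `α(1 + 2cg) ≤ ½` (`c, g ≥ 0`): the display (2.23) and its
bound (2.24)–(2.26) for the σ-independent, symmetric case the print calls *"simpler"*; the general complex case is the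
perturbative argument (2.15)–(2.22) (rows B13.Eq2.15–2.22, by assertion at the leaf (2.16)).
[cite: Balaban1988RG2Cluster, (2.14)–(2.15) p.15, (2.23)–(2.26) p.17] -/
theorem norm_core214_real_le {A : Matrix Λ Λ ℝ} (hA : A.PosDef) (M : Matrix Λ C₀ ℝ)
    (T : Matrix (Λ ⊕ C₀) (Λ ⊕ C₀) ℝ) (F : (Λ → ℝ) → ℂ) {α c g K : ℝ} (hα0 : 0 ≤ α) (hc0 : 0 ≤ c)
    (hc : ∀ k, hA.inv.1.eigenvalues k ≤ c) (hαc : α * c ≤ 1 / 2) (hg : 0 ≤ g)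
    (hΓ : ∀ X : Λ ⊕ C₀ → ℝ, (gamma26 M T X) ⬝ᵥ (A⁻¹ *ᵥ gamma26 M T X) ≤ g * (X ⬝ᵥ X))
    (ha : α * (1 + 2 * c * g) ≤ 1 / 2) (hK : 0 ≤ K) (hF : ∀ B, ‖F B‖ ≤ K * Real.exp (α / 2 * (B ⬝ᵥ B))) :
    ‖cgaussMean (1 : Matrix (Λ ⊕ C₀) (Λ ⊕ C₀) ℂ) (fun X =>
        integrand214 (A.map (algebraMap ℝ ℂ))
          (Gamma214 (M.map (algebraMap ℝ ℂ)) (T.map (algebraMap ℝ ℂ))) F X)‖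
      ≤ K * (Real.exp (α * c * Fintype.card Λ)
          * Real.exp (α * (1 + 2 * c * g) * Fintype.card (Λ ⊕ C₀))) := by
  have hunit : IsUnit A.det := hA.det_pos.ne'.isUnit
  have h1 : (1 : Matrix (Λ ⊕ C₀) (Λ ⊕ C₀) ℂ) = (1 : Matrix (Λ ⊕ C₀) (Λ ⊕ C₀) ℝ).map (algebraMap ℝ ℂ) :=
    (Matrix.map_one _ (map_zero _) (map_one _)).symm
  simp_rw [integrand214_real]
  rw [h1, cgaussMean_real]
  have hfun : (fun X => G26 F A M T X) = fun X : Λ ⊕ C₀ → ℝ =>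
      Real.exp (-(1 / 2 * (((M * T.submatrix Sum.inr id) *ᵥ X) ⬝ᵥ
          (A⁻¹ *ᵥ ((M * T.submatrix Sum.inr id) *ᵥ X)))))
        • gaussMean A⁻¹⁻¹ (fun B : Λ → ℝ => Real.exp (-(((M * T.submatrix Sum.inr id) *ᵥ X) ⬝ᵥ B)) • F B) := by
    funext X
    rw [G26, gamma26_eq_mulVec, Matrix.nonsing_inv_nonsing_inv A hunit]
  rw [hfun]
  have hΓ' : ∀ X : Λ ⊕ C₀ → ℝ, ((M * T.submatrix Sum.inr id) *ᵥ X) ⬝ᵥ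
      (A⁻¹ *ᵥ ((M * T.submatrix Sum.inr id) *ᵥ X)) ≤ g * (X ⬝ᵥ X) := fun X => by
    rw [← gamma26_eq_mulVec]; exact hΓ X
  exact norm_outerMean_le hA.inv (M * T.submatrix Sum.inr id) hα0 hc0 hc hαc hg hΓ' ha hK F hF

end Record

/-! ## §9 (v1.1, append-only). The last line of (2.14) under (2.20) + (2.22): the shape `‖F(B)‖ ≤ K·e^{½α‖B‖²}` -/

section LastLine

open B13Term214 (F214)

variable {D : Type*}

omit [DecidableEq Λ] in
/-- **The last line of (2.14) has the shape `‖F(B)‖ ≤ K·exp(½α‖Z₀B‖²)` used in §7–§8**, p. 16: for the printed last line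
`F(B) = (−1)^{|P|} χ_{k,Y₀}(B) χᶜ_{k,P}(B) exp[Σ_{Y∈𝐃} τ(Y)𝐕_k(Y,B)]` (`B13Term214.F214`), IF the characteristic functions
obey (2.22) — `χ_{k,Y₀}(B)χᶜ_{k,P}(B) ≤ exp(−½γ₂(ε₁²/g_k²)|P| + ½γ₂‖PB‖²)` with `‖PB‖² ≤ ‖Z₀B‖²`, both factors `≥ 0`
(row B13.Eq2.22, `B13.indicator_le_exp_222` factorwise) — and the interaction obeys (2.20) — `Σ_{Y∈𝐃}|τ(Y)||𝐕_k(Y,B)| ≤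
½a‖Z₀B‖² + w` (row B13.Eq2.20, `B13Resum220.ineq220`: `a = O(1)α₄`, `w = O(1)α₄M⁻⁴|Y₀|`) — THEN
`‖F(B)‖ ≤ exp(−½γ₂(ε₁²/g_k²)|P| + w) · exp(½(γ₂ + a)‖Z₀B‖²)`: the constant `K = e^{−½γ₂ε₁²g_k⁻²|P|}·e^{O(1)α₄M⁻⁴|Y₀|}`
and the rate `α = γ₂ + O(1)α₄` (two of the four summands of `α₅`) of the hypothesis `hF` of `norm_innerMean_le` /
`norm_outerMean_le` / `norm_core214_real_le`. [cite: Balaban1988RG2Cluster, (2.20)–(2.22) p.16, (2.23) p.17] -/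
theorem norm_F214_le (cardP : ℕ) (χY₀ χcP : (Λ → ℝ) → ℝ) (Dfam : Finset D) (V : D → (Λ → ℝ) → ℂ) (τ : D → ℂ)
    {γ₂ r a w : ℝ} (qP : (Λ → ℝ) → ℝ) (B : Λ → ℝ) (hχ0 : 0 ≤ χY₀ B) (hχc0 : 0 ≤ χcP B)
    (h222 : χY₀ B * χcP B ≤ Real.exp (-(γ₂ / 2 * r ^ 2 * cardP) + γ₂ / 2 * qP B)) (hγ₂ : 0 ≤ γ₂)
    (hqP : qP B ≤ B ⬝ᵥ B) (h220 : ∑ Y ∈ Dfam, ‖τ Y‖ * ‖V Y B‖ ≤ a / 2 * (B ⬝ᵥ B) + w) :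
    ‖F214 cardP χY₀ χcP Dfam V τ B‖
      ≤ Real.exp (-(γ₂ / 2 * r ^ 2 * cardP) + w) * Real.exp ((γ₂ + a) / 2 * (B ⬝ᵥ B)) := by
  rw [F214, norm_mul, norm_mul, norm_mul, norm_pow, norm_neg, norm_one, one_pow, one_mul, Complex.norm_real,
    Complex.norm_real, Real.norm_eq_abs, Real.norm_eq_abs, abs_of_nonneg hχ0, abs_of_nonneg hχc0, Complex.norm_exp]
  have hre : (∑ Y ∈ Dfam, τ Y * V Y B).re ≤ a / 2 * (B ⬝ᵥ B) + w := by
    rw [Complex.re_sum]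
    refine (Finset.sum_le_sum fun Y _ => ?_).trans h220
    exact (Complex.re_le_norm _).trans (norm_mul_le _ _)
  have h1 : χY₀ B * χcP B ≤ Real.exp (-(γ₂ / 2 * r ^ 2 * cardP) + γ₂ / 2 * (B ⬝ᵥ B)) :=
    h222.trans (Real.exp_le_exp.2 (by nlinarith))
  calc χY₀ B * χcP B * Real.exp (∑ Y ∈ Dfam, τ Y * V Y B).re
      ≤ Real.exp (-(γ₂ / 2 * r ^ 2 * cardP) + γ₂ / 2 * (B ⬝ᵥ B)) * Real.exp (a / 2 * (B ⬝ᵥ B) + w) :=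
        mul_le_mul h1 (Real.exp_le_exp.2 hre) (Real.exp_pos _).le (Real.exp_pos _).le
    _ = Real.exp (-(γ₂ / 2 * r ^ 2 * cardP) + w) * Real.exp ((γ₂ + a) / 2 * (B ⬝ᵥ B)) := by
        rw [← Real.exp_add, ← Real.exp_add]
        ring_nf

end LastLine



end Literature.MathematicalPhysics.QuantumFieldTheory.Balaban1983to89.B13Integral223

end
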